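import Literature.RingTheory.MvPolynomial.ConeBezoutCount
import HarnessLib

/-!
# Refined Bézout counting: the components of a given dimension of a hypersurface section
# `V(g) ∩ V(b : b ∈ B)` number at most `deg g · D^{codim - 1}`, whatever the other components

Topic: `Literature/RingTheory/MvPolynomial`. Let `S = K[X_0, …, X_{m-1}]` over an infinite field,
`g ≠ 0` a form of degree `e ≥ 1`, `B` a set of forms of degree `≤ D` (`D ≥ 1`) and
`𝔞 = (g) + (B)`. Then **any finite set of minimal primes `𝔓` of `𝔞` with `dim S/𝔓 = a + 1`
(`a + 2 ≤ m`) has at most `e · D^{m - (a + 1) - 1}` elements**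
(`card_le_mul_pow_of_minimalPrimes`) — with NO hypothesis on the minimal primes of `𝔞` of larger
dimension. Geometrically: the number of `a`-dimensional irreducible components of the projective
zero set of `g` and `B` in `ℙ^{m-1}` is at most `e D^{m-2-a}`, isolated components lying next to
excess components included; this is the count form of the refined Bézout theorem (Fulton,
*Intersection Theory*, Example 8.4.6: `Σ_i deg Z_i ≤ Π_j deg V_j` over ALL irreducible components
`Z_i` of `⋂ V_j ⊂ ℙⁿ`; Heintz 1983, Thm. 1 (Bézout inequality) in the affine cone), in the shape
"one hypersurface of degree `e`, then forms of degree `≤ D`" needed for polar loci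
(`f = 0`, `rank (∇f, a, b) ≤ 2`: degrees `d; d - 1, …, d - 1`).

The tree's `Literature.RingTheory.MvPolynomial.card_le_pow_of_relevant_minimalPrimes`
(Nesterenko–Philippon LNM 1752, Ch. 11, Prop. 2.2) counts only TOP-dimensional relevant components
(hypothesis `hmax`: no relevant component of larger dimension). The proof here is the same
successive hypersurface-section argument on radicals (`K_0 = (0)`, `K_1 ⊇ (g)`, then cuts by forms
`Q ∈ (B)_D` avoiding the primes of `K_i`, Bézout's Lemma
`leadingCoeff_hilbertPolynomial_le_of_hypersurface` at each step, additivity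
`card_mul_inv_factorial_le_coeff` at the end) with one change that removes `hmax`: `K_i` is the
intersection of those minimal primes of `K_{i-1} + (Q_i)` of dimension `m - i` which lie BELOW
one of the primes `𝔓` being counted. Such a prime cannot contain `𝔞` while its dimension exceeds
`a + 1` (it would equal the minimal prime `𝔓` above it), so the avoidance
(`not_idealDegree_le_of_not_le`, through a variable outside the prime, which exists as its
dimension is positive) goes through at every step, and every `𝔓` still contains a member of each
`K_i` (Krull's principal ideal theorem with catenarity,
`ringKrullDim_quotient_add_one_of_mem_minimalPrimes_sup_span`).

## References

* W. Fulton, *Intersection Theory*, 2nd ed., Springer 1998, Example 8.4.6 (refined Bézout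
  inequality for arbitrary components), Example 12.3.1. [Fulton1998]
* J. Heintz, *Definability and fast quantifier elimination in algebraically closed fields*,
  Theoret. Comput. Sci. 24 (1983) 239–277, Thm. 1, Cor. 1 (Bézout inequality).
* Yu. V. Nesterenko, P. Philippon (eds.), *Introduction to Algebraic Independence Theory*,
  LNM 1752 (2001), Ch. 11 (D. Roy), §2.2 and proof of Prop. 2.2 (the method).
  [NesterenkoPhilippon2001]
-/

noncomputable section

open Module Polynomial

namespace Literature.RingTheory.MvPolynomial

variable {K : Type*} [Field K] {m : ℕ}

/-- `dim S/(x) + 1 = m`... in the usable form: a minimal prime of a non-zero principal ideal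
`(g)` of `S = K[X_0, …, X_{m-1}]` has `dim S/𝔮 = m - 1` (Krull's principal ideal theorem with
catenarity, through the tree's `ringKrullDim_quotient_add_one_of_mem_minimalPrimes_sup_span`
applied to the prime `(0)`). [folklore] -/
theorem ringKrullDim_quotient_of_mem_minimalPrimes_span_singleton {g : MvPolynomial (Fin m) K}
    (hg0 : g ≠ 0) {𝔮 : Ideal (MvPolynomial (Fin m) K)}
    (h𝔮 : 𝔮 ∈ (Ideal.span {g}).minimalPrimes) (hm : 1 ≤ m) :
    ringKrullDim (MvPolynomial (Fin m) K ⧸ 𝔮) = (m - 1 : ℕ) := by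
  haveI : (⊥ : Ideal (MvPolynomial (Fin m) K)).IsPrime := Ideal.isPrime_bot
  have hbot : g ∉ (⊥ : Ideal (MvPolynomial (Fin m) K)) := fun h => hg0 (Ideal.mem_bot.mp h)
  have h𝔮' : 𝔮 ∈ ((⊥ : Ideal (MvPolynomial (Fin m) K)) ⊔ Ideal.span {g}).minimalPrimes := by
    rwa [bot_sup_eq]
  have h := ringKrullDim_quotient_add_one_of_mem_minimalPrimes_sup_span hbot h𝔮'
  rw [ringKrullDim_quotient_bot_mvPolynomial] at h
  have hm1 : ((m : ℕ) : WithBot ℕ∞) = ((m - 1 : ℕ) : WithBot ℕ∞) + 1 := by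
    rw [← Nat.cast_one (R := WithBot ℕ∞), ← Nat.cast_add, Nat.sub_add_cancel hm]
  rw [hm1] at h
  exact ENat.WithBot.add_one_cancel.mp h

/-- **Refined Bézout count of the components of a given dimension** (Fulton, *Intersection
Theory*, Ex. 8.4.6, count form; Heintz 1983 Thm. 1): let `S = K[X_0, …, X_{m-1}]` (`K` infinite),
`g ≠ 0` a form of degree `e ≥ 1`, `B` a set of forms of degree `≤ D` (`D ≥ 1`),
`𝔞 = (g) + (B)` (`= span (insert g B)`), and `a + 2 ≤ m`. Then any finite set `𝓟` of minimal
primes of `𝔞` with `dim S/𝔓 = a + 1` satisfies `|𝓟| ≤ e · D^{m - (a+1) - 1}`. No hypothesis is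
made on the other minimal primes of `𝔞` (components of larger dimension are allowed).
[cite: Fulton1998, Example 8.4.6] -/
theorem card_le_mul_pow_of_minimalPrimes [Infinite K] {e D a : ℕ} (he : 1 ≤ e) (hD : 1 ≤ D)
    {g : MvPolynomial (Fin m) K} (hg0 : g ≠ 0) (hg : g.IsHomogeneous e)
    {B : Set (MvPolynomial (Fin m) K)} (hBdeg : ∀ b ∈ B, ∃ k, k ≤ D ∧ b.IsHomogeneous k)
    {𝔞 : Ideal (MvPolynomial (Fin m) K)} (h𝔞 : 𝔞 = Ideal.span (insert g B)) (ham : a + 2 ≤ m)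
    (𝓟 : Finset (Ideal (MvPolynomial (Fin m) K)))
    (h𝓟 : ∀ 𝔓 ∈ 𝓟, 𝔓 ∈ 𝔞.minimalPrimes ∧
      ringKrullDim (MvPolynomial (Fin m) K ⧸ 𝔓) = (a + 1 : ℕ)) :
    𝓟.card ≤ e * D ^ (m - (a + 1) - 1) := by
  classical
  letI : GradedAlgebra (MvPolynomial.homogeneousSubmodule (Fin m) K) := MvPolynomial.gradedAlgebra
  rcases 𝓟.eq_empty_or_nonempty with h𝓟e | ⟨𝔓₀, h𝔓₀⟩
  · simp [h𝓟e]
  have hm : 0 < m := by omega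
  obtain ⟨r, hr⟩ : ∃ r, r = m - (a + 1) := ⟨_, rfl⟩
  have hr1 : 1 ≤ r := by omega
  rw [← hr]
  -- the two summands of `𝔞`
  set 𝔟 : Ideal (MvPolynomial (Fin m) K) := Ideal.span B with h𝔟def
  have hg𝔞 : g ∈ 𝔞 := by rw [h𝔞]; exact Ideal.subset_span (Set.mem_insert _ _)
  have h𝔟𝔞 : 𝔟 ≤ 𝔞 := by rw [h𝔞, h𝔟def]; exact Ideal.span_mono (Set.subset_insert _ _)
  have h𝔞le : ∀ 𝔮 : Ideal (MvPolynomial (Fin m) K), g ∈ 𝔮 → 𝔟 ≤ 𝔮 → 𝔞 ≤ 𝔮 := by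
    intro 𝔮 hg𝔮 h𝔟𝔮
    rw [h𝔞, Ideal.span_le]
    rintro x (rfl | hx)
    · exact hg𝔮
    · exact h𝔟𝔮 (Ideal.subset_span hx)
  have h𝔞hom : 𝔞.IsHomogeneous (MvPolynomial.homogeneousSubmodule (Fin m) K) := by
    rw [h𝔞]
    refine Ideal.homogeneous_span _ _ ?_
    rintro x (rfl | hx)
    · exact ⟨e, hg⟩
    · obtain ⟨k, -, hk⟩ := hBdeg x hx
      exact ⟨k, hk⟩
  -- a prime below a counted prime `𝔓` and of larger dimension does not contain `𝔞`
  have hnotle : ∀ (𝔮 : Ideal (MvPolynomial (Fin m) K)), 𝔮.IsPrime → ∀ n : ℕ,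
      ringKrullDim (MvPolynomial (Fin m) K ⧸ 𝔮) = n → a + 1 < n → (∃ 𝔓 ∈ 𝓟, 𝔮 ≤ 𝔓) →
      ¬ 𝔞 ≤ 𝔮 := by
    rintro 𝔮 h𝔮p n hn hlt ⟨𝔓, h𝔓𝓟, h𝔮𝔓⟩ h𝔞𝔮
    obtain ⟨h𝔓min, h𝔓dim⟩ := h𝓟 𝔓 h𝔓𝓟
    have heq : 𝔮 = 𝔓 := le_antisymm h𝔮𝔓 (h𝔓min.2 ⟨h𝔮p, h𝔞𝔮⟩ h𝔮𝔓)
    rw [heq, h𝔓dim] at hn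
    have : (a + 1 : ℕ) = n := by exact_mod_cast hn
    omega
  -- the invariant of the construction, at level `i + 1` (`1 ≤ i + 1 ≤ r`)
  have key : ∀ i : ℕ, i + 1 ≤ r → ∃ 𝓠 : Finset (Ideal (MvPolynomial (Fin m) K)),
      𝓠.Nonempty ∧
      (∀ 𝔮 ∈ 𝓠, 𝔮.IsPrime ∧ 𝔮.IsHomogeneous (MvPolynomial.homogeneousSubmodule (Fin m) K) ∧
        ringKrullDim (MvPolynomial (Fin m) K ⧸ 𝔮) = (m - (i + 1) : ℕ) ∧ g ∈ 𝔮 ∧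
        ∃ 𝔓 ∈ 𝓟, 𝔮 ≤ 𝔓) ∧
      (∀ 𝔓 ∈ 𝓟, ∃ 𝔮 ∈ 𝓠, 𝔮 ≤ 𝔓) ∧
      ∃ (P : ℚ[X]) (t₀ : ℕ), (∀ t, t₀ ≤ t →
          (((Module.finrank K (MvPolynomial.homogeneousSubmodule (Fin m) K t) -
              Module.finrank K (idealDegree (𝓠.inf id) t)) : ℕ) : ℚ) = P.eval (t : ℚ)) ∧
        P.natDegree = m - (i + 1) - 1 ∧
        P.leadingCoeff ≤ (e : ℚ) * (D : ℚ) ^ i * ((((m - (i + 1) - 1).factorial : ℕ) : ℚ)⁻¹) := by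
    intro i
    induction i with
    | zero =>
      intro _
      -- `𝓠₁`: the minimal primes of `(g)` lying below a counted prime
      set 𝓠₁ : Finset (Ideal (MvPolynomial (Fin m) K)) :=
        (Ideal.finite_minimalPrimes_of_isNoetherianRing _ (Ideal.span {g})).toFinset.filter
          fun 𝔮 => ∃ 𝔓 ∈ 𝓟, 𝔮 ≤ 𝔓 with h𝓠₁def
      have hmem𝓠₁ : ∀ 𝔮, 𝔮 ∈ 𝓠₁ ↔ 𝔮 ∈ (Ideal.span {g}).minimalPrimes ∧ ∃ 𝔓 ∈ 𝓟, 𝔮 ≤ 𝔓 :=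
        fun 𝔮 => by simp only [h𝓠₁def, Finset.mem_filter, Set.Finite.mem_toFinset]
      have hghom : (Ideal.span {g}).IsHomogeneous (MvPolynomial.homogeneousSubmodule (Fin m) K) :=
        isHomogeneous_span_singleton hg
      have hcov₁ : ∀ 𝔓 ∈ 𝓟, ∃ 𝔮 ∈ 𝓠₁, 𝔮 ≤ 𝔓 := by
        intro 𝔓 h𝔓
        haveI : 𝔓.IsPrime := (h𝓟 𝔓 h𝔓).1.1.1
        have hg𝔓 : Ideal.span {g} ≤ 𝔓 :=
          (Ideal.span_singleton_le_iff_mem _).mpr ((h𝓟 𝔓 h𝔓).1.1.2 hg𝔞)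
        obtain ⟨𝔮, h𝔮min, h𝔮le⟩ := Ideal.exists_minimalPrimes_le hg𝔓
        exact ⟨𝔮, (hmem𝓠₁ 𝔮).mpr ⟨h𝔮min, 𝔓, h𝔓, h𝔮le⟩, h𝔮le⟩
      have h𝓠₁ne : 𝓠₁.Nonempty := by
        obtain ⟨𝔮, h𝔮, -⟩ := hcov₁ 𝔓₀ h𝔓₀
        exact ⟨𝔮, h𝔮⟩
      have h𝓠₁prop : ∀ 𝔮 ∈ 𝓠₁, 𝔮.IsPrime ∧
          𝔮.IsHomogeneous (MvPolynomial.homogeneousSubmodule (Fin m) K) ∧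
          ringKrullDim (MvPolynomial (Fin m) K ⧸ 𝔮) = (m - (0 + 1) : ℕ) ∧ g ∈ 𝔮 ∧
          ∃ 𝔓 ∈ 𝓟, 𝔮 ≤ 𝔓 := by
        intro 𝔮 h𝔮
        obtain ⟨hmin, hbelow⟩ := (hmem𝓠₁ 𝔮).mp h𝔮
        refine ⟨hmin.1.1, isHomogeneous_of_mem_minimalPrimes hghom hmin, ?_,
          hmin.1.2 (Ideal.mem_span_singleton_self g), hbelow⟩
        rw [Nat.zero_add]
        exact ringKrullDim_quotient_of_mem_minimalPrimes_span_singleton hg0 hmin (by omega)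
      -- Hilbert polynomial of `K₁ = ⋂𝓠₁ ⊇ (g)`, compared with that of `(0)`
      obtain ⟨P₀, hP₀, hP₀deg, hP₀lc⟩ := hilbertPolynomial_bot (K := K) (by omega : 1 ≤ m)
      have hK₁hom : (𝓠₁.inf id).IsHomogeneous (MvPolynomial.homogeneousSubmodule (Fin m) K) :=
        isHomogeneous_finset_inf fun 𝔮 h𝔮 => (h𝓠₁prop 𝔮 h𝔮).2.1
      obtain ⟨P₁, t₁, hP₁⟩ := exists_hilbertPolynomial (𝓠₁.inf id) hK₁hom
      have hK₁dim : ringKrullDim (MvPolynomial (Fin m) K ⧸ 𝓠₁.inf id) = (m - (0 + 1) : ℕ) :=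
        ringKrullDim_quotient_finset_inf h𝓠₁ne fun 𝔮 h𝔮 => (h𝓠₁prop 𝔮 h𝔮).2.2.1
      have hP₁deg : P₁.natDegree = m - (0 + 1) - 1 := by
        have h := natDegree_hilbertPolynomial hK₁hom (b := m - (0 + 1) - 1)
          (by rw [hK₁dim]; congr 1; omega) hP₁
        exact h.1
      have hbothom : (⊥ : Ideal (MvPolynomial (Fin m) K)).IsHomogeneous
          (MvPolynomial.homogeneousSubmodule (Fin m) K) := Ideal.IsHomogeneous.bot _
      have hnzd₀ : ∀ f, g * f ∈ (⊥ : Ideal (MvPolynomial (Fin m) K)) →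
          f ∈ (⊥ : Ideal (MvPolynomial (Fin m) K)) := by
        intro f hf
        rw [Ideal.mem_bot] at hf ⊢
        exact (mul_eq_zero.mp hf).resolve_left hg0
      have hJ' : (⊥ : Ideal (MvPolynomial (Fin m) K)) ⊔ Ideal.span {g} ≤ 𝓠₁.inf id := by
        rw [bot_sup_eq]
        exact Finset.le_inf fun 𝔮 h𝔮 => ((hmem𝓠₁ 𝔮).mp h𝔮).1.1.2
      have hlc := leadingCoeff_hilbertPolynomial_le_of_hypersurface hbothom hg0 hg hnzd₀ hJ'
        (t₀ := t₁) (fun t _ => hP₀ t) (fun t ht => hP₁ t ht) (by rw [hP₀deg]; omega)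
        (by rw [hP₁deg, hP₀deg]) he
      refine ⟨𝓠₁, h𝓠₁ne, h𝓠₁prop, hcov₁, P₁, t₁, hP₁, hP₁deg, hlc.trans ?_⟩
      -- `e · (m-1) · 1/(m-1)! = e / (m-2)!`
      rw [hP₀deg, hP₀lc, pow_zero, mul_one]
      have hfac : (((m - 1).factorial : ℕ) : ℚ) =
          ((m - 1 : ℕ) : ℚ) * (((m - (0 + 1) - 1).factorial : ℕ) : ℚ) := by
        rw [show m - 1 = (m - (0 + 1) - 1) + 1 by omega, Nat.factorial_succ]
        push_cast
        ring
      have hpos : (0 : ℚ) < ((m - 1 : ℕ) : ℚ) := by exact_mod_cast (show 0 < m - 1 by omega)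
      have hfpos : (0 : ℚ) < (((m - (0 + 1) - 1).factorial : ℕ) : ℚ) := by
        exact_mod_cast Nat.factorial_pos _
      rw [hfac, mul_inv, ← mul_assoc, mul_assoc (e : ℚ), mul_inv_cancel₀ hpos.ne', mul_one]
    | succ i ih =>
      intro hi
      have hi' : i + 1 ≤ r := Nat.le_of_succ_le hi
      obtain ⟨hmi, hA2, hA3, hA4, hA5, hA6⟩ := coneCount_arith hr hi
      obtain ⟨𝓠, h𝓠ne, h𝓠, hcov, P, t₀, hP, hPdeg, hPlc⟩ := ih hi'
      -- `𝔟 ⊄ 𝔮` for `𝔮 ∈ 𝓠`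
      have hnot : ∀ 𝔮 ∈ 𝓠, ¬ 𝔟 ≤ 𝔮 := by
        intro 𝔮 h𝔮 hle
        obtain ⟨h1, -, h3, h4, h5⟩ := h𝓠 𝔮 h𝔮
        exact hnotle 𝔮 h1 _ h3 (by omega) h5 (h𝔞le 𝔮 h4 hle)
      -- a form `Q ∈ 𝔟_D` outside every `𝔮 ∈ 𝓠`
      obtain ⟨Q, hQ𝔟D, hQ⟩ := exists_mem_forall_notMem_of_forall_not_le (K := K)
        (idealDegree 𝔟 D) (𝓠.image fun 𝔮 : Ideal (MvPolynomial (Fin m) K) => 𝔮.restrictScalars K)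
        (by
          intro W hW
          obtain ⟨𝔮, h𝔮, rfl⟩ := Finset.mem_image.mp hW
          haveI := (h𝓠 𝔮 h𝔮).1
          obtain ⟨j, hj⟩ := exists_X_notMem_of_ringKrullDim_ne_zero (𝔭 := 𝔮)
            (by rw [(h𝓠 𝔮 h𝔮).2.2.1]; exact_mod_cast (show m - (i + 1) ≠ 0 by omega))
          exact not_idealDegree_le_of_not_le h𝔟def hBdeg hj (hnot 𝔮 h𝔮))
      have hQ𝓠 : ∀ 𝔮 ∈ 𝓠, Q ∉ 𝔮 := fun 𝔮 h𝔮 =>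
        hQ (𝔮.restrictScalars K) (Finset.mem_image_of_mem _ h𝔮)
      obtain ⟨𝔮₀, h𝔮₀⟩ := h𝓠ne
      have hQ0 : Q ≠ 0 := fun h => hQ𝓠 𝔮₀ h𝔮₀ (h ▸ Submodule.zero_mem _)
      have hQD : Q.IsHomogeneous D := hQ𝔟D.2
      have hQ𝔞 : Q ∈ 𝔞 := h𝔟𝔞 hQ𝔟D.1
      -- `K = ⋂𝓠`
      have hKhom : (𝓠.inf id).IsHomogeneous (MvPolynomial.homogeneousSubmodule (Fin m) K) :=
        isHomogeneous_finset_inf fun 𝔮 h𝔮 => (h𝓠 𝔮 h𝔮).2.1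
      have hnzd : ∀ f, Q * f ∈ 𝓠.inf id → f ∈ 𝓠.inf id :=
        mem_finset_inf_of_mul_mem (fun 𝔮 h𝔮 => (h𝓠 𝔮 h𝔮).1) hQ𝓠
      have hKdim : ringKrullDim (MvPolynomial (Fin m) K ⧸ 𝓠.inf id) = (m - (i + 1) : ℕ) :=
        ringKrullDim_quotient_finset_inf ⟨𝔮₀, h𝔮₀⟩ fun 𝔮 h𝔮 => (h𝓠 𝔮 h𝔮).2.2.1
      have hgK : g ∈ 𝓠.inf id := by
        rw [Submodule.mem_finsetInf]
        intro 𝔮 h𝔮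
        exact (h𝓠 𝔮 h𝔮).2.2.2.1
      have hKQhom : (𝓠.inf id ⊔ Ideal.span {Q}).IsHomogeneous
          (MvPolynomial.homogeneousSubmodule (Fin m) K) :=
        hKhom.sup (isHomogeneous_span_singleton hQD)
      -- the next family: minimal primes of `K + (Q)` of dimension `m - (i+2)` below a counted prime
      set 𝓠' : Finset (Ideal (MvPolynomial (Fin m) K)) :=
        (Ideal.finite_minimalPrimes_of_isNoetherianRing _ (𝓠.inf id ⊔ Ideal.span {Q})).toFinset.filter
          fun 𝔮' => ringKrullDim (MvPolynomial (Fin m) K ⧸ 𝔮') = (m - (i + 1 + 1) : ℕ) ∧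
            ∃ 𝔓 ∈ 𝓟, 𝔮' ≤ 𝔓 with h𝓠'def
      have hmem𝓠' : ∀ 𝔮', 𝔮' ∈ 𝓠' ↔ 𝔮' ∈ (𝓠.inf id ⊔ Ideal.span {Q}).minimalPrimes ∧
          ringKrullDim (MvPolynomial (Fin m) K ⧸ 𝔮') = (m - (i + 1 + 1) : ℕ) ∧
          ∃ 𝔓 ∈ 𝓟, 𝔮' ≤ 𝔓 := fun 𝔮' => by
        simp only [h𝓠'def, Finset.mem_filter, Set.Finite.mem_toFinset]
      -- every counted prime contains a member of `𝓠'`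
      have hcov' : ∀ 𝔓 ∈ 𝓟, ∃ 𝔮' ∈ 𝓠', 𝔮' ≤ 𝔓 := by
        intro 𝔓 h𝔓
        obtain ⟨h𝔓min, h𝔓dim⟩ := h𝓟 𝔓 h𝔓
        haveI : 𝔓.IsPrime := h𝔓min.1.1
        obtain ⟨𝔮, h𝔮, h𝔮𝔓⟩ := hcov 𝔓 h𝔓
        have hKQ : 𝓠.inf id ⊔ Ideal.span {Q} ≤ 𝔓 :=
          sup_le ((Finset.inf_le h𝔮).trans h𝔮𝔓)
            ((Ideal.span_singleton_le_iff_mem _).mpr (h𝔓min.1.2 hQ𝔞))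
        obtain ⟨𝔮', h𝔮'min, h𝔮'𝔓⟩ := Ideal.exists_minimalPrimes_le hKQ
        have h𝔮'prime : 𝔮'.IsPrime := h𝔮'min.1.1
        refine ⟨𝔮', (hmem𝓠' 𝔮').mpr ⟨h𝔮'min, ?_, 𝔓, h𝔓, h𝔮'𝔓⟩, h𝔮'𝔓⟩
        -- dimension of `𝔮'`: it is minimal over `𝔮₁ + (Q)` for some `𝔮₁ ∈ 𝓠`
        obtain ⟨𝔮₁, h𝔮₁, h𝔮₁le⟩ :=
          (Ideal.IsPrime.inf_le' h𝔮'prime).mp (le_sup_left.trans h𝔮'min.1.2)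
        haveI := (h𝓠 𝔮₁ h𝔮₁).1
        have hmin₁ : 𝔮' ∈ (𝔮₁ ⊔ Ideal.span {Q}).minimalPrimes := by
          refine ⟨⟨h𝔮'prime, sup_le h𝔮₁le (le_sup_right.trans h𝔮'min.1.2)⟩, ?_⟩
          intro P' hP' hP'le
          exact h𝔮'min.2 ⟨hP'.1, (sup_le_sup_right (Finset.inf_le h𝔮₁) _).trans hP'.2⟩ hP'le
        have hA7 := ringKrullDim_quotient_add_one_of_mem_minimalPrimes_sup_span (hQ𝓠 𝔮₁ h𝔮₁) hmin₁
        rw [(h𝓠 𝔮₁ h𝔮₁).2.2.1, hA2] at hA7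
        exact ENat.WithBot.add_natCast_cancel.mp hA7
      have h𝓠'ne : 𝓠'.Nonempty := by
        obtain ⟨𝔮', h𝔮', -⟩ := hcov' 𝔓₀ h𝔓₀
        exact ⟨𝔮', h𝔮'⟩
      have h𝓠'prop : ∀ 𝔮' ∈ 𝓠', 𝔮'.IsPrime ∧
          𝔮'.IsHomogeneous (MvPolynomial.homogeneousSubmodule (Fin m) K) ∧
          ringKrullDim (MvPolynomial (Fin m) K ⧸ 𝔮') = (m - (i + 1 + 1) : ℕ) ∧ g ∈ 𝔮' ∧
          ∃ 𝔓 ∈ 𝓟, 𝔮' ≤ 𝔓 := by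
        intro 𝔮' h𝔮'
        obtain ⟨hmin, hdim, hbelow⟩ := (hmem𝓠' 𝔮').mp h𝔮'
        exact ⟨hmin.1.1, isHomogeneous_of_mem_minimalPrimes hKQhom hmin, hdim,
          hmin.1.2 (Ideal.mem_sup_left hgK), hbelow⟩
      -- Hilbert polynomial of `K' = ⋂𝓠'`
      have hK'hom : (𝓠'.inf id).IsHomogeneous (MvPolynomial.homogeneousSubmodule (Fin m) K) :=
        isHomogeneous_finset_inf fun 𝔮' h𝔮' => (h𝓠'prop 𝔮' h𝔮').2.1
      obtain ⟨P', t₁, hP'⟩ := exists_hilbertPolynomial (𝓠'.inf id) hK'hom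
      have hK'dim : ringKrullDim (MvPolynomial (Fin m) K ⧸ 𝓠'.inf id) = (m - (i + 1 + 1) : ℕ) :=
        ringKrullDim_quotient_finset_inf h𝓠'ne fun 𝔮' h𝔮' => (h𝓠'prop 𝔮' h𝔮').2.2.1
      have hP'deg : P'.natDegree = m - (i + 1 + 1) - 1 := by
        have h := natDegree_hilbertPolynomial hK'hom (b := m - (i + 1 + 1) - 1)
          (by rw [hK'dim, ← hA3]) hP'
        exact h.1
      have hKK' : 𝓠.inf id ⊔ Ideal.span {Q} ≤ 𝓠'.inf id :=
        Finset.le_inf fun 𝔮' h𝔮' => ((hmem𝓠' 𝔮').mp h𝔮').1.1.2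
      have hlc := leadingCoeff_hilbertPolynomial_le_of_hypersurface hKhom hQ0 hQD hnzd hKK'
        (t₀ := max t₀ t₁) (fun t ht => hP t (le_of_max_le_left ht))
        (fun t ht => hP' t (le_of_max_le_right ht)) (by rw [hPdeg]; exact hA4)
        (by rw [hP'deg, hPdeg, hA5]) hD
      refine ⟨𝓠', h𝓠'ne, h𝓠'prop, hcov', P', t₁, hP', hP'deg, hlc.trans ?_⟩
      -- `D · (m-i-2) · e D^i/(m-i-2)! = e D^{i+1}/(m-i-3)!`
      rw [hPdeg]
      have hfac : (((m - (i + 1) - 1).factorial : ℕ) : ℚ) =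
          ((m - (i + 1) - 1 : ℕ) : ℚ) * (((m - (i + 1 + 1) - 1).factorial : ℕ) : ℚ) := by
        rw [hA6, Nat.factorial_succ]
        push_cast
        ring
      have hpos : (0 : ℚ) < ((m - (i + 1) - 1 : ℕ) : ℚ) := by exact_mod_cast hA4
      have hfpos : (0 : ℚ) < (((m - (i + 1 + 1) - 1).factorial : ℕ) : ℚ) := by
        exact_mod_cast Nat.factorial_pos _
      have hDpos : (0 : ℚ) < (D : ℚ) := by exact_mod_cast hD
      have hepos : (0 : ℚ) < (e : ℚ) := by exact_mod_cast he
      calc (D : ℚ) * ((m - (i + 1) - 1 : ℕ) : ℚ) * P.leadingCoeff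
          ≤ (D : ℚ) * ((m - (i + 1) - 1 : ℕ) : ℚ) *
              ((e : ℚ) * (D : ℚ) ^ i * ((((m - (i + 1) - 1).factorial : ℕ) : ℚ)⁻¹)) :=
            mul_le_mul_of_nonneg_left hPlc (mul_nonneg hDpos.le hpos.le)
        _ = (e : ℚ) * (D : ℚ) ^ (i + 1) * ((((m - (i + 1 + 1) - 1).factorial : ℕ) : ℚ)⁻¹) := by
            rw [hfac]
            field_simp
            ring
  -- conclusion: at level `r` the counted primes are among `𝓠_r`
  obtain ⟨𝓠, h𝓠ne, h𝓠, hcov, P, t₀, hP, hPdeg, hPlc⟩ := key (r - 1) (by omega)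
  have hmr : m - (r - 1 + 1) = a + 1 := by omega
  have hsub : 𝓟 ⊆ 𝓠 := by
    intro 𝔓 h𝔓
    obtain ⟨𝔮, h𝔮, h𝔮𝔓⟩ := hcov 𝔓 h𝔓
    haveI := (h𝓠 𝔮 h𝔮).1
    haveI := (h𝓟 𝔓 h𝔓).1.1.1
    have hdim𝔮 := (h𝓠 𝔮 h𝔮).2.2.1
    rw [hmr] at hdim𝔮
    rwa [← eq_of_le_of_ringKrullDim_quotient_eq h𝔮𝔓 hdim𝔮 (h𝓟 𝔓 h𝔓).2]
  refine (Finset.card_le_card hsub).trans ?_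
  -- `|𝓠| / a! ≤ coeff_a P = lc P ≤ e D^{r-1} / a!`
  have hcount := card_mul_inv_factorial_le_coeff (K := K) (a := a) 𝓠 h𝓠ne
    (fun 𝔮 h𝔮 => ⟨(h𝓠 𝔮 h𝔮).1, (h𝓠 𝔮 h𝔮).2.1, by rw [(h𝓠 𝔮 h𝔮).2.2.1, hmr]⟩) P t₀ hP
  have hdega : P.natDegree = a := by rw [hPdeg]; omega
  rw [show m - (r - 1 + 1) - 1 = a by omega] at hPlc
  have hcoeff : P.coeff a = P.leadingCoeff := by rw [Polynomial.leadingCoeff, hdega]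
  rw [hcoeff] at hcount
  have h := hcount.trans hPlc
  have hfpos : (0 : ℚ) < (((a.factorial : ℕ) : ℚ)) := by exact_mod_cast Nat.factorial_pos _
  have h' : (𝓠.card : ℚ) ≤ (e : ℚ) * (D : ℚ) ^ (r - 1) := by
    have := mul_le_mul_of_nonneg_right h hfpos.le
    rwa [mul_assoc, inv_mul_cancel₀ hfpos.ne', mul_one, mul_assoc, inv_mul_cancel₀ hfpos.ne',
      mul_one] at this
  exact_mod_cast h'

end Literature.RingTheory.MvPolynomial

end
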